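import Summits.QuantumFields.YangMills.Theorems.BalabanUVNodesN10AtRecord11B13
import Literature.MathematicalPhysics.QuantumFieldTheory.Balaban1983to89.B13CubeSumTorus

/-!
# BalabanUVNodes ∕ N10 — NON-VACUITY OF THE [B13] JUNCTION AT NODE 00's GROUP OF RECORD: the located hypothesis list of
# `…N10AtRecord11B13.b13LeafOfRecord_of_located` is JOINTLY SATISFIABLE at a residual layer with FULL configuration spaces, at EVERY
# Stage-3 parameter (Track A, DAG node N10 [Balaban1988RG2Cluster] Lemmas 1–3 pp. 9, 11, 20; seat `pub-ymgap-dag-n10-d`; the «inhabited-at»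
# audit def-B13's A2-ANSWER and dag-ref-B READ-371 A2 ask of the ₁₂ re-key, for the [B13] leaf)

HONEST FRAMING.  Count-neutral kernel bookkeeping; N10 is NOT discharged; nothing of Bałaban's is asserted.  def-B13's honesty theorems
(`Node00.exists_residB13_b13LeafOfRecord` ∕ `_not_b13LeafOfRecord`) show the [B13] leaf of record is junk-inhabitable with EMPTY spaces
`sp1 = sp2 = ∅` (every `φ ∈ sp1 Y`-quantified clause vacuous) and junk-refutable through `GaugeInv := False`.  This file answers the next audit
question for THIS SEAT's junction theorem (p459088 §1, 60 binders): are its located hypotheses jointly satisfiable when the spaces are FULL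
(`sp1 Y = sp2 Z = Set.univ`, so every `φ ∈ sp1 Y` binder ranges over all configurations), the Lemma-3 restriction sentence `Restr` is TRUE, the
coupling `g ≠ 0`, and the residual constants meet print's thresholds (κ, δκ ≥ κ₀(64, 8); κ₁ ≥ 1 + 2 log(8·12³), ≥ 2 + 16 log 128; δ₀M ≥ 10e⁻¹,
≥ 2 log 5; δκ ≥ 1; R8; R9; ε₁ > 0)?  YES, at EVERY `θ : Stage3Params` (so at the record's own parameters): `located_junction_nonvacuous` exhibits
the layer (fine torus `12·(θ.ℓ₆+1)` cubes per direction, `k = 0`, `Φ = E = ℂ`, one bond, all (1.33) index families EMPTY and all terms ZERO —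
dag-p2's `B13Lemma1BlocksTorusNonvacuity` witness transported to NODE 00's objects of record, with the distance reading `dist ≡ 60·(θ.ℓ₆+1)`
certified by `B13CubeSumTorus.image_pbox_eq_univ`) and OBTAINS `B13LeafOfRecord θ lam` THROUGH `b13LeafOfRecord_of_located` — the proof term
discharges each of its 60 hypotheses at the witness (the Lemma-3 FLAG `h3` included: H ≡ 0 meets (2.38) since `C₃(c13OfRecord) ε₁ ≥ 0`).
WHAT THIS DOES NOT SAY: the witness carries no analysis (zero activity, empty index families); it certifies only that the typed hypothesis
LIST is consistent with full spaces and print's numeric restrictions — «non-emptiness ≠ contentfulness» (dag-ref-B READ-377 A2) stands, and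
the contentful reading is the LAW layer's affair.  KEYING: the statement is a STAGE-3 statement (`θ : Stage3Params`, the junction's own key); it
rests on NO record predicate — in particular NOT on `IsRecordOfRecord₁₁C` being inhabited (it is not: def-T's `Node00.not_isRecordOfRecord₁₁C`; dag-ref-I
ADDENDUM-1) — and applies unchanged under the ₁₂ re-key (the [B13] pin at ₁₂ reads the same Stage-3 objects).  One finite four-torus programme at fixed ε; nothing continuum ∕ ℝ⁴ ∕ OS ∕ mass-gap ∕
Clay.  0 `sorry`, 0 `def`, standard axioms.  Filed `--supports` K1 of route «BalabanUVNodes».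
-/

noncomputable section

namespace Summit.QuantumFields.YangMills.BalabanUVNodes.N10AtRecord11B13Nonvacuity

open Literature.MathematicalPhysics.QuantumFieldTheory.Balaban1983to89
open Literature.MathematicalPhysics.QuantumFieldTheory.Balaban1983to89.Node00
open Literature.MathematicalPhysics.QuantumFieldTheory.Balaban1983to89.B16Absorption (pbox)
open Literature.MathematicalPhysics.QuantumFieldTheory.Balaban1983to89.TreeLengthTorus
open Literature.MathematicalPhysics.QuantumFieldTheory.Balaban1983to89.B12TreeDecay (kappa₀ K₀ K₀_pos a₀)
open Literature.MathematicalPhysics.QuantumFieldTheory.Balaban1983to89.B13CubeSumTorus (image_pbox_eq_univ)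
open Literature.MathematicalPhysics.QuantumFieldTheory.Balaban1983to89.B13Lemma3TorusTerms (terms)
open Summit.QuantumFields.YangMills.BalabanUVNodes.N10AtRecord11B13 (b13LeafOfRecord_of_located)

/-- κ₀(64, 8) = 64·log(2·9²) ≤ 64·162 (log x ≤ x − 1); numeric plumbing (dag-p2's private lemma, re-derived). [folklore] -/
private theorem kappa₀_64_8_le : kappa₀ 64 8 ≤ 64 * 162 := by
  unfold kappa₀ a₀
  have h : Real.log (2 * ((8 : ℕ) + 1 : ℝ) ^ 2) ≤ 162 := by
    have := Real.log_le_sub_one_of_pos (show (0:ℝ) < 2 * ((8 : ℕ) + 1 : ℝ) ^ 2 by positivity)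
    norm_num at this ⊢; linarith
  nlinarith

set_option maxHeartbeats 400000 in
/-- **NON-VACUITY OF THE LOCATED [B13] JUNCTION AT THE GROUP OF RECORD, AT EVERY STAGE-3 PARAMETER.**  For every `θ : Stage3Params` there is a
residual [B13] term layer `lam : ResidB13 θ` with FULL spaces (`sp1 Y = Set.univ`, `sp2 Z = Set.univ`), `Restr` true, `g ≠ 0`, a fine torus of
`12·(θ.ℓ₆+1)` cubes per direction, residual constants meeting the displayed thresholds of pp. 7–9 (listed as conjuncts), at which the [B13]
LEAF OF RECORD `B13LeafOfRecord θ lam` (Lemma 1 ∧ Lemma 2 ∧ Lemma 3 AS PRINTED at `WtOfRecord θ lam` ∕ `c13OfRecord θ lam`) HOLDS — obtained THROUGH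
`N10AtRecord11B13.b13LeafOfRecord_of_located` with every one of its 60 hypotheses discharged at the witness (K = K′ = 0, ϑ = 0, R = 4, K₂ = 0,
m₂ = 0, `dist ≡ 60·(θ.ℓ₆+1)`; the FLAG `h3` by H ≡ 0; `maxHeartbeats 400000` = 2× default for the one 60-binder application at a concrete
38-field layer, as `Node00.termDomination_WtOfRecord`).  p. 21: *"The assumptions allow finally us to fix all the constants, or rather bounds on
these constants."*  Stage-3 keyed: rests on no record predicate (not on ₁₁C inhabitation).  Count-neutral: the witness is the all-zero step with empty (1.33) index families; it certifies consistency of the typed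
list with full spaces, not content. [cite: Balaban1988RG2Cluster, Lemma 1 p.9, Lemma 2 p.11, Lemma 3 p.20, p.21 (closing paragraph: the constants can be fixed)] -/
theorem located_junction_nonvacuous (θ : Stage3Params) :
    ∃ lam : ResidB13 θ,
      (∀ Y, lam.sp1 Y = Set.univ) ∧ (∀ Z, lam.sp2 Z = Set.univ) ∧ lam.Restr ∧ lam.g ≠ 0 ∧ 12 ≤ (θ.ℓ₆ + 1) * (lam.n + 1) ∧
      kappa₀ 64 8 ≤ lam.c.κ ∧ kappa₀ 64 8 ≤ lam.c.δ * lam.c.κ ∧ 0 ≤ lam.c.κ ∧ lam.c.δ < 1 ∧ 1 ≤ lam.c.δ * lam.c.κ ∧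
      1 + 2 * Real.log (8 * 12 ^ 3) ≤ lam.c.κ₁ ∧ 2 + 16 * Real.log 128 ≤ lam.c.κ₁ ∧
      10 * Real.exp (-1) ≤ lam.c.δ₀ * lam.c.M ∧ 2 * Real.log 5 ≤ lam.c.δ₀ * lam.c.M ∧
      (1 - lam.c.δ) * lam.c.κ ≤ (1 / 4) * (lam.c.κ₁ - 1) ∧ (1 - 2 * lam.c.δ) * lam.c.κ ≤ (1 / 16) * lam.c.κ₁ ∧
      0 < lam.c.ε₁ ∧ 0 ≤ lam.c.C₃ ∧ 0 < lam.c.E₀ * lam.c.ε₁ * lam.c.C₁ * lam.c.M ^ lam.c.q * Real.exp (lam.c.C₂ * lam.c.κ₁) ∧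
      B13LeafOfRecord θ lam := by
  -- the witness constants (dag-p2's `B13Lemma1BlocksTorusNonvacuity` numbers; `L` is immaterial — `c13OfRecord` sets `L := θ.ℓ₆ + 1`)
  let c : B13.Consts :=
    { L := 0, q := 0, M := 10, κ := 20000, κ₁ := 1000000, δ := 99 / 100, δ₀ := 1, E₀ := 1, ε₁ := 1, C₁ := 1,
      C₂ := 50, C₃ := 1, α₀ := 1, α₁ := 1, α₄ := 1, α₅ := 1, α₆ := 1, γ₂ := 1, γ := 1, A₁ := 1, A₂ := 1 }
  -- the full-space all-zero residual layer on the fine torus with 12·(θ.ℓ₆+1) cubes per direction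
  let lam : ResidB13 θ :=
    { n := 11, k := 0, Φ := ℂ, Bond := Unit, sp1 := fun _ => Set.univ, sp2 := fun _ => Set.univ, Bv := fun _ _ => 0,
      S0 := fun _ => ∅, F := fun _ _ => ∅, Sq := fun _ _ _ => ∅, SX := fun _ _ _ _ => ∅, T := fun _ _ _ _ _ _ _ => 0,
      Sc := fun _ => ∅, Sq' := fun _ _ _ => ∅, SX' := fun _ _ _ _ => ∅, T' := fun _ _ _ _ _ _ => 0, Gl := fun _ _ => 0,
      E := ℂ, ι₂ := Unit, s := fun _ => ∅, Wf := fun _ _ _ _ => 0, g := 1, e := fun _ _ => 0, m₃ := 0, T₃ := fun _ _ _ => 0,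
      Ek1 := fun _ _ => 0, Elog := fun _ _ => 0, GaugeInv := fun _ => True, Repr17 := True, Restr := True, c := c }
  have hk : lam.k = 0 := rfl
  have hn11 : lam.n = 11 := rfl
  have hcδ₀ : lam.c.δ₀ = 1 := rfl
  have hcM : lam.c.M = 10 := rfl
  have hκ₀ := kappa₀_64_8_le
  have hlog1 : Real.log (8 * 12 ^ 3) ≤ 13824 := by
    have := Real.log_le_sub_one_of_pos (show (0:ℝ) < 8 * 12 ^ 3 by norm_num); norm_num at this ⊢; linarith
  have hlog2 : Real.log 128 ≤ 128 := by
    have := Real.log_le_sub_one_of_pos (show (0:ℝ) < 128 by norm_num); linarith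
  have hlog5 : Real.log 5 ≤ 5 := by
    have := Real.log_le_sub_one_of_pos (show (0:ℝ) < 5 by norm_num); linarith
  have hexp1 : Real.exp (-1) ≤ 1 := Real.exp_le_one_iff.mpr (by norm_num)
  -- numeric thresholds at `lam.c = c`
  have hN12 : 12 ≤ (θ.ℓ₆ + 1) * (lam.n + 1) := by
    rw [hn11]
    exact Nat.le_mul_of_pos_left (11 + 1) (Nat.succ_pos _)
  have hκ : (0 : ℝ) ≤ lam.c.κ := by show (0:ℝ) ≤ 20000; norm_num
  have hδ1 : lam.c.δ < 1 := by show (99 : ℝ) / 100 < 1; norm_num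
  have hδκ : 1 ≤ lam.c.δ * lam.c.κ := by show (1 : ℝ) ≤ 99 / 100 * 20000; norm_num
  have hκ126 : kappa₀ 64 8 ≤ lam.c.κ := by show kappa₀ 64 8 ≤ 20000; linarith
  have hκ126' : kappa₀ 64 8 ≤ lam.c.δ * lam.c.κ := by show kappa₀ 64 8 ≤ 99 / 100 * 20000; linarith
  have hκ₁ : 1 + 2 * Real.log (8 * 12 ^ 3) ≤ lam.c.κ₁ := by show 1 + 2 * Real.log (8 * 12 ^ 3) ≤ 1000000; linarith
  have hκ₁' : 2 + 16 * Real.log 128 ≤ lam.c.κ₁ := by show 2 + 16 * Real.log 128 ≤ 1000000; linarith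
  have hδ₀M : 10 * Real.exp (-1) ≤ lam.c.δ₀ * lam.c.M := by show 10 * Real.exp (-1) ≤ 1 * 10; linarith
  have hδ₀M5 : 2 * Real.log 5 ≤ lam.c.δ₀ * lam.c.M := by show 2 * Real.log 5 ≤ 1 * 10; linarith
  have hR8 : (1 - lam.c.δ) * lam.c.κ ≤ (1 / 4) * (lam.c.κ₁ - 1) := by
    show (1 - (99 : ℝ) / 100) * 20000 ≤ (1 / 4) * (1000000 - 1); norm_num
  have hR9 : (1 - 2 * lam.c.δ) * lam.c.κ ≤ (1 / 16) * lam.c.κ₁ := by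
    show (1 - 2 * ((99 : ℝ) / 100)) * 20000 ≤ (1 / 16) * 1000000; norm_num
  have hε₁ : (0 : ℝ) < lam.c.ε₁ := by show (0:ℝ) < 1; norm_num
  have hC₃ : (0 : ℝ) ≤ lam.c.C₃ := by show (0:ℝ) ≤ 1; norm_num
  have hRHS : 0 < lam.c.E₀ * lam.c.ε₁ * lam.c.C₁ * lam.c.M ^ lam.c.q * Real.exp (lam.c.C₂ * lam.c.κ₁) := by
    show (0 : ℝ) < 1 * 1 * 1 * 10 ^ (0 : ℕ) * Real.exp (50 * 1000000); positivity
  -- the Lemma-3 FLAG at the witness: H ≡ 0 meets (2.38) (`C₃(c13OfRecord θ lam) ε₁ ≥ 0`)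
  have h3 : B13.Lemma3Printed (WtOfRecord θ lam).toStepData (c13OfRecord θ lam) := by
    intro _ Z φ _
    have hH : (WtOfRecord θ lam).toStepData.H Z φ = 0 := by
      show (∑ t ∈ terms (θ.ℓ₆ + 1) (lam.m₃ + 1) Z, lam.T₃ Z t φ) = 0
      exact Finset.sum_eq_zero fun _ _ => rfl
    simp only [hH, norm_zero]
    refine mul_nonneg ?_ (Real.exp_pos _).le
    have hA₁ : (c13OfRecord θ lam).A₁ = 1 := rfl
    have hE₀ : (c13OfRecord θ lam).E₀ = 1 := rfl
    have hC₁ : (c13OfRecord θ lam).C₁ = 1 := rfl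
    have hα₄ : (c13OfRecord θ lam).α₄ = 1 := rfl
    have hα₆ : (c13OfRecord θ lam).α₆ = 1 := rfl
    have hM' : (c13OfRecord θ lam).M = 10 := rfl
    have hq' : (c13OfRecord θ lam).q = 0 := rfl
    have hε' : (c13OfRecord θ lam).ε₁ = 1 := rfl
    unfold B13.Consts.C3act B13.Consts.K₀
    simp only [hA₁, hE₀, hC₁, hα₄, hα₆, hM', hq', hε']
    positivity
  refine ⟨lam, fun _ => rfl, fun _ => rfl, trivial, one_ne_zero, hN12, hκ126, hκ126', hκ, hδ1, hδκ, hκ₁, hκ₁', hδ₀M, hδ₀M5,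
    hR8, hR9, hε₁, hC₃, hRHS, ?_⟩
  -- THE LEAF THROUGH THE JUNCTION: every located hypothesis discharged at the witness
  refine b13LeafOfRecord_of_located θ lam hN12 (fun _ _ _ _ => 10 * (6 * ((θ.ℓ₆ : ℝ) + 1))) (K := 0) (K' := 0)
    ?_ ?_ ?_ ?_ ?_ ?_ ?_ ?_ ?_ ?_ ?_ le_rfl le_rfl hκ hδ1 hδκ hκ126 hκ126' hκ₁ hκ₁' hδ₀M hδ₀M5 hR8 hR9 ?_ ?_
    (ϑ := 0) le_rfl zero_lt_one ?_ ?_ ?_ ?_ one_ne_zero (R := 4) (K₂ := 0) (m₂ := 0) le_rfl (by norm_num) (by norm_num)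
    ?_ ?_ ?_ ?_ ?_ ?_ ?_ h3
  · intro Y a ha; exact (Finset.notMem_empty a ha).elim
  · intro Y a; exact Finset.empty_subset _
  · intro Y a ha; exact (Finset.notMem_empty a ha).elim
  · intro Y; exact Finset.empty_subset _
  · intro Y a j q; simp only [hcδ₀]; positivity
  · intro Y a j n q hq
    simp only [hcδ₀, hcM, one_mul]
    rcases le_or_gt (6 * (θ.ℓ₆ + 1)) (n + 2) with hn | hn
    · refine (hq ?_).elim
      have hA : (((θ.ℓ₆ + 1) ^ (lam.k - j) : ℕ) : ℤ) = 1 := by rw [hk, Nat.zero_sub, pow_zero, Nat.cast_one]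
      have hP : (((θ.ℓ₆ + 1) ^ (lam.k - j) * ((θ.ℓ₆ + 1) * (lam.n + 1)) : ℕ) : ℤ) = 12 * (θ.ℓ₆ : ℤ) + 12 := by
        rw [hk, hn11, Nat.zero_sub, pow_zero, one_mul]; push_cast; ring
      rw [image_pbox_eq_univ _ fun i => ?_]
      · exact Finset.mem_univ _
      · simp only [hA, hP]
        push_cast
        omega
    · have : (n : ℝ) + 2 < 6 * ((θ.ℓ₆ : ℝ) + 1) := by exact_mod_cast hn
      linarith
  · intro Y a j q; exact Finset.empty_subset _
  · intro Y a j q; exact Finset.empty_subset _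
  · intro Y a ha; exact (Finset.notMem_empty a ha).elim
  · intro Y a ha; exact (Finset.notMem_empty a ha).elim
  · intro Y a ha; exact (Finset.notMem_empty a ha).elim
  · intro Y φ _ a ha; exact (Finset.notMem_empty a ha).elim
  · intro Y φ _ a ha; exact (Finset.notMem_empty a ha).elim
  · show (0 : ℝ) * K₀ 64 8 * (2 * (6 * ((θ.ℓ₆ + 1 : ℕ) : ℝ)) ^ 4) * Real.exp 1 * Real.exp ((1 / 8) * lam.c.κ₁ * (12 ^ 4 - 1)) +
        2 * (64 * 0) * K₀ 64 8 * 1344 ≤ (1 - 0) * (lam.c.E₀ * lam.c.ε₁ * lam.c.C₁ * lam.c.M ^ lam.c.q * Real.exp (lam.c.C₂ * lam.c.κ₁))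
    have := hRHS.le
    simpa using this
  · intro Y; exact fun _ _ => analyticAt_const
  · intro Y φ _; show ‖(0 : ℂ)‖ ≤ _; simp
  · intro Y b; show ‖(0 : ℂ)‖ ≤ 1; simp
  · intro Y i hi; exact (Finset.notMem_empty i hi).elim
  · intro Y i hi; exact (Finset.notMem_empty i hi).elim
  · intro Y; show (∅ : Finset Unit).card ≤ 0 * Y.1.card; simp
  · intro Y φ _
    show ‖(1 : ℂ)‖ * ‖lam.rd Y φ‖ < 1
    have : lam.rd Y φ = 0 := by
      show (∑ b : Unit, (0 : ℂ) • (0 : ℂ)) = 0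
      simp
    rw [this]; simp
  · show 27 * ((0 : ℕ) : ℝ) * 0 * Real.exp (lam.c.κ₁ - 1) ≤ lam.c.C₃ * lam.c.M ^ 4 * Real.exp (lam.c.C₂ * lam.c.κ₁)
    have : (0 : ℝ) ≤ lam.c.C₃ * lam.c.M ^ 4 * Real.exp (lam.c.C₂ * lam.c.κ₁) := by
      show (0 : ℝ) ≤ 1 * 10 ^ 4 * Real.exp (50 * 1000000); positivity
    simpa using this
  · intro Y i hi; exact (Finset.notMem_empty i hi).elim
  · intro Y; exact ⟨trivial, trivial, trivial⟩

end Summit.QuantumFields.YangMills.BalabanUVNodes.N10AtRecord11B13Nonvacuity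

end
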